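import Literature.AlgebraicGeometry.Modules.SectionExtension
import Literature.AlgebraicGeometry.Morphisms.DevissageIdealPowers
import Literature.AlgebraicGeometry.Morphisms.DevissageRankZero
import Mathlib.Topology.Sheaves.SheafCondition.Sites
import HarnessLib

/-!
# The morphism `𝒥₂𝒪_Z → M` defined by a section of `M` over `D(b₀)` (step (iii) of the dévissage)

Setting (Görtz–Wedhorn I, Lemma 12.63 (iii); the extension lemma EGA I 9.4.7 / Hartshorne II Ex. 5.15
in the affine-local form of `Modules/SectionExtension`): `Z = V(𝒥) ↪ X` (any ideal sheaf `𝒥`; prime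
in the application), a quasi-coherent (affine-localizing, `IsAffineLocalizing`) `M` with `𝒥M = 0` and
without `𝓘`-torsion for the ideal `𝓘` of the closed set `X ∖ D(b₀)` (`b₀ ∈ Γ(W, 𝒪_X)`), and a
section `s ∈ Γ(D(b₀), M)`; coherence / local Noetherianity enter only through `[IsLocallyNoetherian X]`
(finitely generated `𝓘(V)`, needed for the uniqueness of extensions, `unique_B`). For an exponent `n`
(part of the data) and `𝒥₂ := 𝒥 + 𝓘ⁿ`, we construct the morphism
of `𝒪_X`-modules `φ : 𝒥₂𝒪_Z → M` (`𝒥₂𝒪_Z = ker(ι_*𝒪_Z → ι_*𝒪_{Z₂})`, `Morphisms/DevissageIdealPowers`)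
"`h ↦ h · s`": on the principal affine opens `D(h)` of a finite affine covering (a basis of `X`) it
sends a section `k`, lifted to a function `ã ∈ 𝒥₂(D(h))`, to the unique extension of `ã · s`
(`SectionExtension`), and it is extended to all opens by the sheaf property (Mathlib
`TopCat.Sheaf.restrictHomEquivHom`).

* the uniform exponent `n` (the "`n ≫ 0`" of the printed proof) is part of the data `ExtSetup`
  (fields `n`, `hn`), not proved in this file; its existence is established where the data is
  assembled, in `Morphisms/DevissageHeart` (`heart_induction`: `Modules/SectionExtension`'s
  `exists_isExtension_of_affine` on each piece of a finite affine covering, then the maximum);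
* `extB` and its specification (`isExtension_extB`, `extB_eq`); `extHom` — **the morphism `φ`**, with
  `extHom_app_B` (its value on the basis opens) and `extHom_app_eq_smul` ("`h ↦ h · s`" over `D(b₀)`).

Everything is proved; no named facts.

## References

* U. Görtz, T. Wedhorn, *Algebraic Geometry I*, 2nd ed. (2020): Lemma 12.63 (iii), p. 437. [GortzWedhorn2020]
* A. Grothendieck, EGA I (1960), 9.4.7. [EGAIII1]
-/

noncomputable section

open CategoryTheory CategoryTheory.Limits AlgebraicGeometry TopologicalSpace Opposite
open Literature.AlgebraicGeometry.Modules

universe u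

namespace Literature.AlgebraicGeometry.Morphisms

variable {X : Scheme.{u}}

/-- The closed set `X ∖ D(b₀)`. [folklore] -/
abbrev complBasicOpen {W : X.Opens} (b₀ : Γ(X, W)) : Closeds X :=
  ⟨((X.basicOpen b₀ : X.Opens) : Set X)ᶜ, (X.basicOpen b₀).isOpen.isClosed_compl⟩

/-- The ideal sheaf `𝓘` of `X ∖ D(b₀)`. [folklore] -/
abbrev complIdeal {W : X.Opens} (b₀ : Γ(X, W)) : X.IdealSheafData :=
  Scheme.IdealSheafData.vanishingIdeal (complBasicOpen b₀)

section Geometry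

variable {W : X.Opens} (b₀ : Γ(X, W))

/-- `D(g) ⊆ D(b₀)` for `g ∈ 𝓘(V)`. [folklore] -/
theorem basicOpen_le_of_mem_complIdeal {V : X.Opens} (hV : IsAffineOpen V) {g : Γ(X, V)}
    (hg : g ∈ (complIdeal b₀).ideal ⟨V, hV⟩) : X.basicOpen g ≤ X.basicOpen b₀ :=
  basicOpen_le_of_mem_vanishingIdeal_compl b₀ hV hg

/-- A point of `V ∩ D(b₀)` lies in some `D(g)`, `g ∈ 𝓘(V)`. [folklore] -/
theorem exists_mem_basicOpen_of_mem {V : X.Opens} (hV : IsAffineOpen V) {x : X} (hxV : x ∈ V)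
    (hxb : x ∈ X.basicOpen b₀) : ∃ g ∈ (complIdeal b₀).ideal ⟨V, hV⟩, x ∈ X.basicOpen g := by
  by_contra hno
  push Not at hno
  have hx : x ∈ (complIdeal b₀).support := by
    rw [Scheme.IdealSheafData.mem_support_iff_of_mem (U := ⟨V, hV⟩) hxV, Scheme.mem_zeroLocus_iff]
    exact hno
  have hx' : x ∈ ((complIdeal b₀).support : Set X) := hx
  rw [Scheme.IdealSheafData.coe_support_vanishingIdeal] at hx'
  exact hx' hxb

end Geometry

section Restrict

variable {M : X.Modules} {I : X.IdealSheafData} {W₀ : X.Opens} {s : Γ(M, W₀)}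

/-- **Extensions restrict to extensions** on smaller affine opens, provided every point of
`V ∩ W₀` lies in some `D(g')`, `g' ∈ 𝓘(V)`. [folklore] -/
theorem IsExtension.restrict {V V' : X.Opens} {hV : IsAffineOpen V} {hV' : IsAffineOpen V'}
    (hle : V' ≤ V) (hIW₀ : ∀ g ∈ I.ideal ⟨V, hV⟩, X.basicOpen g ≤ W₀)
    (hcov : ∀ x ∈ V, x ∈ W₀ → ∃ g' ∈ I.ideal ⟨V, hV⟩, x ∈ X.basicOpen g')
    {a : Γ(X, V)} {x : Γ(M, V)} (hx : IsExtension M I s hV a x) :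
    IsExtension M I s hV' (X.presheaf.map (homOfLE hle).op a) (M.presheaf.map (homOfLE hle).op x) := by
  intro g hg hgW
  -- cover `D(g)` by the `D(g · g'|)`, `g' ∈ 𝓘(V)`
  let K : Type u := {g' : Γ(X, V) // g' ∈ I.ideal ⟨V, hV⟩}
  have hcov' : X.basicOpen g ≤ ⨆ k : K, X.basicOpen (g * X.presheaf.map (homOfLE hle).op k.1) := by
    intro y hy
    obtain ⟨g', hg', hy'⟩ := hcov y (hle (X.basicOpen_le g hy)) (hgW hy)
    refine Opens.mem_iSup.mpr ⟨⟨g', hg'⟩, ?_⟩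
    rw [Scheme.basicOpen_mul, Scheme.basicOpen_res]
    exact ⟨hy, X.basicOpen_le g hy, hy'⟩
  apply (abSheafOf M).eq_of_locally_eq' (fun k : K => X.basicOpen (g * X.presheaf.map (homOfLE hle).op k.1))
    (X.basicOpen g) (fun k => homOfLE (basicOpen_mul_le_left g _)) hcov'
  intro k
  obtain ⟨g', hg'⟩ := k
  have hC1 : X.basicOpen (g * X.presheaf.map (homOfLE hle).op g') ≤ X.basicOpen g :=
    basicOpen_mul_le_left g _
  have hC2 : X.basicOpen (g * X.presheaf.map (homOfLE hle).op g') ≤ X.basicOpen g' := by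
    refine (basicOpen_mul_le_right g _).trans ?_
    rw [Scheme.basicOpen_res]; exact inf_le_right
  change M.presheaf.map (homOfLE hC1).op _ = M.presheaf.map (homOfLE hC1).op _
  rw [← sub_eq_zero, ← map_sub, map_sub, Scheme.Modules.map_smul, map_map, map_map, map_map,
    ringMap_map, ringMap_map, sub_eq_zero]
  have h1 := restrict_numerator_eq (hIW₀ g' hg') (hx g' hg' (hIW₀ g' hg')) hC2
  refine (map_eq_map M _ _ x).trans (h1.trans ?_)
  exact congrArg₂ (fun φ ψ => X.presheaf.map φ a • M.presheaf.map ψ s) (Subsingleton.elim _ _)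
    (Subsingleton.elim _ _)

/-- Existence of extensions on `V` for all `a ∈ 𝓘(V)ⁿ` gives existence on every affine `V' ⊆ V` for
all `a ∈ 𝓘(V')ⁿ`. [folklore] -/
theorem exists_isExtension_of_le {V V' : X.Opens} {hV : IsAffineOpen V} {hV' : IsAffineOpen V'}
    (hle : V' ≤ V) (hIW₀ : ∀ g ∈ I.ideal ⟨V, hV⟩, X.basicOpen g ≤ W₀)
    (hcov : ∀ x ∈ V, x ∈ W₀ → ∃ g' ∈ I.ideal ⟨V, hV⟩, x ∈ X.basicOpen g') {n : ℕ}
    (hex : ∀ a ∈ I.ideal ⟨V, hV⟩ ^ n, ∃ x : Γ(M, V), IsExtension M I s hV a x) :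
    ∀ a ∈ I.ideal ⟨V', hV'⟩ ^ n, ∃ x : Γ(M, V'), IsExtension M I s hV' a x := by
  intro a ha
  rw [← I.map_ideal (U := ⟨V', hV'⟩) (V := ⟨V, hV⟩) hle, ← Ideal.map_pow] at ha
  refine Submodule.span_induction (p := fun a _ => ∃ x : Γ(M, V'), IsExtension M I s hV' a x)
    ?_ ?_ ?_ ?_ ha
  · rintro _ ⟨μ, hμ, rfl⟩
    obtain ⟨x, hx⟩ := hex μ hμ
    exact ⟨_, IsExtension.restrict hle hIW₀ hcov hx⟩
  · exact ⟨0, IsExtension.zero⟩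
  · rintro a b - - ⟨x, hx⟩ ⟨x', hx'⟩
    exact ⟨x + x', hx.add hx'⟩
  · rintro c a - ⟨x, hx⟩
    exact ⟨c • x, hx.smul c⟩

end Restrict

section Setup

/-- **The data of the construction**: an ideal sheaf `𝒥` (arbitrary here; prime in the application
`Morphisms/DevissageHeart`), the module `M` (`𝒥M = 0`, affine-localizing, without `𝓘`-torsion), an
open `W` with the function `b₀`, the section `s` over `D(b₀)`, a finite affine covering `t`, and an
exponent `n` for which `a · s` extends on every covering piece for all `a ∈ 𝓘ⁿ` (an ASSUMPTION here,
field `hn`; produced in `Morphisms/DevissageHeart` from `exists_isExtension_of_affine`). [folklore] -/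
structure ExtSetup (X : Scheme.{u}) where
  /-- the ideal sheaf of `Z` -/
  J : X.IdealSheafData
  /-- the module -/
  M : X.Modules
  /-- `M` is affine-localizing (quasi-coherent) -/
  hM : IsAffineLocalizing M
  /-- `𝒥M = 0` -/
  hJM : IsKilledBy J M
  /-- the open carrying `b₀` -/
  W : X.Opens
  /-- the function whose principal open `D(b₀)` carries the section -/
  b₀ : Γ(X, W)
  /-- the section to be multiplied -/
  s : Γ(M, X.basicOpen b₀)
  /-- `M` has no `𝓘`-torsion, `𝓘` the ideal of `X ∖ D(b₀)` -/
  htf : ∀ ⦃V : X.Opens⦄ (hV : IsAffineOpen V) (m : Γ(M, V)),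
    (∀ a ∈ (complIdeal b₀).ideal ⟨V, hV⟩, a • m = 0) → m = 0
  /-- a finite affine covering -/
  t : Finset X.affineOpens
  /-- the covering covers -/
  ht : ⨆ V : t, ((V : X.affineOpens) : X.Opens) = ⊤
  /-- the exponent -/
  n : ℕ
  /-- `a · s` extends on every covering piece for `a ∈ 𝓘ⁿ` -/
  hn : ∀ (V : t) (a : Γ(X, ((V : X.affineOpens) : X.Opens))),
    a ∈ (complIdeal b₀).ideal (V : X.affineOpens) ^ n →
      ∃ x, IsExtension M (complIdeal b₀) s (V : X.affineOpens).2 a x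

variable (D : ExtSetup X)

namespace ExtSetup

/-- `𝒥₂ := 𝒥 + 𝓘ⁿ`. [folklore] -/
abbrev J₂ : X.IdealSheafData := D.J ⊔ complIdeal D.b₀ ^ D.n

/-- `𝒥 ≤ 𝒥₂`. [folklore] -/
theorem le_J₂ : D.J ≤ D.J₂ := le_sup_left

/-- The source `𝒥₂𝒪_Z`. [folklore] -/
abbrev H : X.Modules := idealOZ D.J D.le_J₂

/-- The index type of the basis: functions on covering pieces. [folklore] -/
def ιB : Type u := Σ V : D.t, Γ(X, ((V : X.affineOpens) : X.Opens))

/-- The basis of principal opens of covering pieces. [folklore] -/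
def B : D.ιB → X.Opens := fun p => X.basicOpen p.2

/-- Basis opens lie in their covering piece. [folklore] -/
theorem B_le (p : D.ιB) : D.B p ≤ ((p.1 : X.affineOpens) : X.Opens) := X.basicOpen_le _

/-- Basis opens are affine. [folklore] -/
theorem isAffineOpen_B (p : D.ιB) : IsAffineOpen (D.B p) := (p.1 : X.affineOpens).2.basicOpen _

/-- The principal opens of the covering pieces form a basis. [folklore] -/
theorem isBasis_B : Opens.IsBasis (Set.range D.B) := by
  rw [Opens.isBasis_iff_nbhd]
  intro U x hx
  have hx' : x ∈ (⊤ : X.Opens) := trivial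
  rw [← D.ht] at hx'
  obtain ⟨V, hV⟩ := Opens.mem_iSup.mp hx'
  obtain ⟨g, hgU, hxg⟩ := (V : X.affineOpens).2.exists_basicOpen_le (V := U) ⟨x, hx⟩ hV
  exact ⟨X.basicOpen g, ⟨⟨V, g⟩, rfl⟩, hxg, hgU⟩

/-- `D(g) ⊆ D(b₀)` for `g ∈ 𝓘(U)`, `U` affine. [folklore] -/
theorem hIW₀ {U : X.Opens} (hU : IsAffineOpen U) :
    ∀ g ∈ (complIdeal D.b₀).ideal ⟨U, hU⟩, X.basicOpen g ≤ X.basicOpen D.b₀ :=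
  fun _ hg => basicOpen_le_of_mem_complIdeal D.b₀ hU hg

/-- Extensions of `a · s` exist on the basis opens for `a ∈ 𝓘ⁿ`. [folklore] -/
theorem exists_B (p : D.ιB) (a : Γ(X, D.B p)) (ha : a ∈ (complIdeal D.b₀).ideal ⟨D.B p, D.isAffineOpen_B p⟩ ^ D.n) :
    ∃ x, IsExtension D.M (complIdeal D.b₀) D.s (D.isAffineOpen_B p) a x :=
  exists_isExtension_of_le (hV := (p.1 : X.affineOpens).2) (D.B_le p) (D.hIW₀ (p.1 : X.affineOpens).2)
    (fun _ hxV hxb => exists_mem_basicOpen_of_mem D.b₀ (p.1 : X.affineOpens).2 hxV hxb) (D.hn p.1) a ha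

/-- Extensions of `ã · s` exist on the basis opens for `ã ∈ 𝒥₂` (the `𝒥`-part of `ã` kills `M`).
[folklore] -/
theorem exists_B_of_mem_J₂ (p : D.ιB) (a : Γ(X, D.B p))
    (ha : a ∈ D.J₂.ideal ⟨D.B p, D.isAffineOpen_B p⟩) :
    ∃ x, IsExtension D.M (complIdeal D.b₀) D.s (D.isAffineOpen_B p) a x := by
  rw [Scheme.IdealSheafData.ideal_sup] at ha
  obtain ⟨j, hj, a', ha', rfl⟩ := Submodule.mem_sup.mp ha
  rw [Scheme.IdealSheafData.ideal_pow, Pi.pow_apply] at ha'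
  obtain ⟨x, hx⟩ := D.exists_B p a' ha'
  refine ⟨0 + x, IsExtension.add (IsExtension.zero_of_smul_eq_zero fun g hg hgW => ?_) hx⟩
  have hgaff : IsAffineOpen (X.basicOpen g) := (D.isAffineOpen_B p).basicOpen g
  exact D.hJM ⟨X.basicOpen g, hgaff⟩ _
    (D.J.ideal_le_comap_ideal (U := ⟨X.basicOpen g, hgaff⟩) (V := ⟨D.B p, D.isAffineOpen_B p⟩)
      (X.basicOpen_le g) hj) _

/-- A lift of the section `k` of `𝒥₂𝒪_Z ⊆ ι_*𝒪_Z` over the affine `U` to a function on `U`. [folklore] -/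
def lift {U : X.Opens} (hU : IsAffineOpen U) (k : Γ(D.H, U)) : Γ(X, U) :=
  (D.J.subschemeι_app_surjective ⟨U, hU⟩ ((kernel.ι (idealOZHom D.J D.le_J₂)).app U k)).choose

/-- `lift` lifts. [folklore] -/
theorem lift_spec {U : X.Opens} (hU : IsAffineOpen U) (k : Γ(D.H, U)) :
    D.J.subschemeι.app U (D.lift hU k) = (kernel.ι (idealOZHom D.J D.le_J₂)).app U k :=
  (D.J.subschemeι_app_surjective ⟨U, hU⟩ ((kernel.ι (idealOZHom D.J D.le_J₂)).app U k)).choose_spec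

/-- Any lift of a section of `𝒥₂𝒪_Z` lies in `𝒥₂`. [folklore] -/
theorem mem_J₂_of_app_eq {U : X.Opens} (hU : IsAffineOpen U) (k : Γ(D.H, U)) {a : Γ(X, U)}
    (ha : D.J.subschemeι.app U a = (kernel.ι (idealOZHom D.J D.le_J₂)).app U k) :
    a ∈ D.J₂.ideal ⟨U, hU⟩ := by
  rw [← Scheme.IdealSheafData.ker_subschemeι_app D.J₂ ⟨U, hU⟩, RingHom.mem_ker,
    ← Scheme.IdealSheafData.inclusion_subschemeι D.le_J₂, Scheme.Hom.comp_app]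
  change (Scheme.IdealSheafData.inclusion D.le_J₂).app _ (D.J.subschemeι.app U a) = 0
  rw [ha, ← pushforwardUnitHom_app_apply]
  exact app_kernel_ι_app (idealOZHom D.J D.le_J₂) U k

/-- Two lifts differ by an element of `𝒥(U)`, which kills `M`: an extension for one lift is an
extension for the other. [folklore] -/
theorem isExtension_of_lifts (p : D.ιB) (k : Γ(D.H, D.B p)) {a a' : Γ(X, D.B p)}
    (ha : D.J.subschemeι.app _ a = (kernel.ι (idealOZHom D.J D.le_J₂)).app _ k)
    (ha' : D.J.subschemeι.app _ a' = (kernel.ι (idealOZHom D.J D.le_J₂)).app _ k)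
    {x : Γ(D.M, D.B p)} (hx : IsExtension D.M (complIdeal D.b₀) D.s (D.isAffineOpen_B p) a x) :
    IsExtension D.M (complIdeal D.b₀) D.s (D.isAffineOpen_B p) a' x := by
  have hj : a' - a ∈ D.J.ideal ⟨D.B p, D.isAffineOpen_B p⟩ := by
    rw [← Scheme.IdealSheafData.ker_subschemeι_app D.J ⟨D.B p, D.isAffineOpen_B p⟩, RingHom.mem_ker,
      map_sub]
    change D.J.subschemeι.app _ a' - D.J.subschemeι.app _ a = 0
    rw [ha, ha', sub_self]
  have h0 : IsExtension D.M (complIdeal D.b₀) D.s (D.isAffineOpen_B p) (a' - a) 0 := by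
    refine IsExtension.zero_of_smul_eq_zero fun g hg hgW => ?_
    have hgaff : IsAffineOpen (X.basicOpen g) := (D.isAffineOpen_B p).basicOpen g
    exact D.hJM ⟨X.basicOpen g, hgaff⟩ _
      (D.J.ideal_le_comap_ideal (U := ⟨X.basicOpen g, hgaff⟩) (V := ⟨D.B p, D.isAffineOpen_B p⟩)
        (X.basicOpen_le g) hj) _
  have := h0.add hx
  rwa [sub_add_cancel, zero_add] at this

/-- Extensions on the basis opens are unique. [folklore] -/
theorem unique_B [IsLocallyNoetherian X] (p : D.ιB) {a : Γ(X, D.B p)} {x x' : Γ(D.M, D.B p)}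
    (hx : IsExtension D.M (complIdeal D.b₀) D.s (D.isAffineOpen_B p) a x)
    (hx' : IsExtension D.M (complIdeal D.b₀) D.s (D.isAffineOpen_B p) a x') : x = x' :=
  hx.unique D.hM (IdealSheafData.fg_ideal _ _) (D.htf (D.isAffineOpen_B p)) hx' (D.hIW₀ _)

/-- **The extension on a basis open**: the unique extension of `ã · s` for a lift `ã` of `k`.
[folklore] -/
def extB (p : D.ιB) (k : Γ(D.H, D.B p)) : Γ(D.M, D.B p) :=
  (D.exists_B_of_mem_J₂ p (D.lift (D.isAffineOpen_B p) k)
    (D.mem_J₂_of_app_eq (D.isAffineOpen_B p) k (D.lift_spec _ k))).choose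

/-- `extB k` extends `(lift k) · s`. [folklore] -/
theorem isExtension_extB (p : D.ιB) (k : Γ(D.H, D.B p)) :
    IsExtension D.M (complIdeal D.b₀) D.s (D.isAffineOpen_B p) (D.lift (D.isAffineOpen_B p) k) (D.extB p k) :=
  (D.exists_B_of_mem_J₂ p (D.lift (D.isAffineOpen_B p) k)
    (D.mem_J₂_of_app_eq (D.isAffineOpen_B p) k (D.lift_spec _ k))).choose_spec

variable [IsLocallyNoetherian X]

/-- **Characterisation of `extB`**: any extension of `ã · s` for any lift `ã` of `k` is `extB k`.
[folklore] -/
theorem extB_eq (p : D.ιB) (k : Γ(D.H, D.B p)) {a : Γ(X, D.B p)}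
    (ha : D.J.subschemeι.app _ a = (kernel.ι (idealOZHom D.J D.le_J₂)).app _ k)
    {x : Γ(D.M, D.B p)} (hx : IsExtension D.M (complIdeal D.b₀) D.s (D.isAffineOpen_B p) a x) :
    D.extB p k = x :=
  D.unique_B p (D.isExtension_extB p k) (D.isExtension_of_lifts p k ha (D.lift_spec _ k) hx)

/-- `extB` is additive. [folklore] -/
theorem extB_add (p : D.ιB) (k k' : Γ(D.H, D.B p)) : D.extB p (k + k') = D.extB p k + D.extB p k' := by
  refine D.extB_eq p (k + k') (a := D.lift (D.isAffineOpen_B p) k + D.lift (D.isAffineOpen_B p) k') ?_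
    ((D.isExtension_extB p k).add (D.isExtension_extB p k'))
  rw [map_add, D.lift_spec, D.lift_spec]
  exact (map_add _ k k').symm

/-- `extB` is `Γ(D(h), 𝒪_X)`-linear. [folklore] -/
theorem extB_smul (p : D.ιB) (r : Γ(X, D.B p)) (k : Γ(D.H, D.B p)) :
    D.extB p (r • k) = r • D.extB p k := by
  refine D.extB_eq p (r • k) (a := r * D.lift (D.isAffineOpen_B p) k) ?_ ((D.isExtension_extB p k).smul r)
  rw [map_mul, D.lift_spec, Scheme.Modules.Hom.app_smul]
  rfl

/-- `extB` commutes with restriction between basis opens. [folklore] -/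
theorem extB_restrict {p q : D.ιB} (hle : D.B q ≤ D.B p) (k : Γ(D.H, D.B p)) :
    D.extB q (D.H.presheaf.map (homOfLE hle).op k) = D.M.presheaf.map (homOfLE hle).op (D.extB p k) := by
  refine D.extB_eq q _ (a := X.presheaf.map (homOfLE hle).op (D.lift (D.isAffineOpen_B p) k)) ?_
    (IsExtension.restrict hle (D.hIW₀ _)
      (fun x hxV hxb => exists_mem_basicOpen_of_mem D.b₀ (D.isAffineOpen_B p) hxV hxb)
      (D.isExtension_extB p k))
  have h1 := ConcreteCategory.congr_hom (D.J.subschemeι.naturality (homOfLE hle).op)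
    (D.lift (D.isAffineOpen_B p) k)
  have h2 : D.J.subschemeι.app (D.B q) (X.presheaf.map (homOfLE hle).op (D.lift (D.isAffineOpen_B p) k)) =
      ((Scheme.Modules.pushforward D.J.subschemeι).obj
        (SheafOfModules.unit D.J.subscheme.ringCatSheaf)).presheaf.map (homOfLE hle).op
          (D.J.subschemeι.app (D.B p) (D.lift (D.isAffineOpen_B p) k)) := h1
  rw [h2, D.lift_spec, map_app]

/-- The family `extB` as a natural transformation on the basis (induced category). [folklore] -/
def α : (inducedFunctor D.B).op ⋙ D.H.presheaf ⟶ (inducedFunctor D.B).op ⋙ (abSheafOf D.M).1 where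
  app P := AddCommGrpCat.ofHom (AddMonoidHom.mk' (D.extB P.unop) (D.extB_add P.unop))
  naturality P Q f := by
    ext (k : Γ(D.H, D.B P.unop))
    have hle : D.B Q.unop ≤ D.B P.unop := ((inducedFunctor D.B).map f.unop).le
    have e1 : ((inducedFunctor D.B).map f.unop).op = (homOfLE hle).op := Subsingleton.elim _ _
    change D.extB Q.unop (D.H.presheaf.map ((inducedFunctor D.B).map f.unop).op k) =
      D.M.presheaf.map ((inducedFunctor D.B).map f.unop).op (D.extB P.unop k)
    rw [e1]
    exact D.extB_restrict hle k

/-- The morphism of abelian sheaves `𝒥₂𝒪_Z → M` extending `extB` from the basis (Mathlib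
`TopCat.Sheaf.restrictHomEquivHom`). [folklore] -/
def φ₀ : D.H.presheaf ⟶ D.M.presheaf :=
  TopCat.Sheaf.restrictHomEquivHom D.H.presheaf (abSheafOf D.M) D.isBasis_B D.α

/-- On the basis opens, `φ₀` is `extB`. [folklore] -/
theorem φ₀_app_B (p : D.ιB) (k : Γ(D.H, D.B p)) : (D.φ₀).app (op (D.B p)) k = D.extB p k :=
  ConcreteCategory.congr_hom (TopCat.Sheaf.extend_hom_app D.H.presheaf (abSheafOf D.M) D.isBasis_B D.α p) k

/-- `φ₀` commutes with restrictions (naturality, elementwise). [folklore] -/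
theorem map_φ₀_app {U V : X.Opens} (i : op U ⟶ op V) (k : Γ(D.H, U)) :
    D.M.presheaf.map i (D.φ₀.app (op U) k) = D.φ₀.app (op V) (D.H.presheaf.map i k) :=
  (ConcreteCategory.congr_hom (D.φ₀.naturality i) k).symm

/-- **`φ₀` is `𝒪_X`-linear on all opens** (by locality from the basis). [folklore] -/
theorem φ₀_smul (U : X.Opens) (r : Γ(X, U)) (k : Γ(D.H, U)) :
    D.φ₀.app (op U) (r • k) = r • D.φ₀.app (op U) k := by
  let K : Type u := {p : D.ιB // D.B p ≤ U}
  have hcov : U ≤ ⨆ q : K, D.B q.1 := by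
    intro x hx
    obtain ⟨V, ⟨p, rfl⟩, hxV, hVU⟩ := Opens.isBasis_iff_nbhd.mp D.isBasis_B hx
    exact Opens.mem_iSup.mpr ⟨⟨p, hVU⟩, hxV⟩
  apply (abSheafOf D.M).eq_of_locally_eq' (fun q : K => D.B q.1) U (fun q => homOfLE q.2) hcov
  intro q
  change D.M.presheaf.map (homOfLE q.2).op (D.φ₀.app _ (r • k)) =
    D.M.presheaf.map (homOfLE q.2).op (r • D.φ₀.app _ k)
  rw [Scheme.Modules.map_smul, D.map_φ₀_app, D.map_φ₀_app, Scheme.Modules.map_smul, D.φ₀_app_B,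
    D.φ₀_app_B, D.extB_smul]

/-- **The morphism `φ : 𝒥₂𝒪_Z → M` of `𝒪_X`-modules "multiplication by `s`".**
[cite: GortzWedhorn2020, Lemma 12.63 (iii) (p. 437)] -/
def extHom : D.H ⟶ D.M :=
  ⟨PresheafOfModules.homMk D.φ₀ fun U r k => D.φ₀_smul U.unop r k⟩

/-- On the basis opens, `φ` is `extB`. [folklore] -/
theorem extHom_app_B (p : D.ιB) (k : Γ(D.H, D.B p)) : (D.extHom).app (D.B p) k = D.extB p k :=
  D.φ₀_app_B p k

/-- **The defining property of `φ` on a basis open `D(h)`**: for any lift `ã` of `k` and any section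
`m` of `M` over `D(h)` agreeing with `s` on the `D(g)`, `g ∈ 𝓘(D(h))`, we have `φ(k) = ã · m`.
[folklore] -/
theorem extHom_app_eq_smul (p : D.ιB) (k : Γ(D.H, D.B p)) {a : Γ(X, D.B p)}
    (ha : D.J.subschemeι.app _ a = (kernel.ι (idealOZHom D.J D.le_J₂)).app _ k) (m : Γ(D.M, D.B p))
    (hm : ∀ (g : Γ(X, D.B p)), g ∈ (complIdeal D.b₀).ideal ⟨D.B p, D.isAffineOpen_B p⟩ →
      ∀ (hg : X.basicOpen g ≤ X.basicOpen D.b₀),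
        D.M.presheaf.map (homOfLE (X.basicOpen_le g)).op m = D.M.presheaf.map (homOfLE hg).op D.s) :
    (D.extHom).app (D.B p) k = a • m := by
  rw [D.extHom_app_B]
  refine D.extB_eq p k ha fun g hg hgW => ?_
  rw [Scheme.Modules.map_smul, hm g hg hgW]

end ExtSetup

end Setup

end Literature.AlgebraicGeometry.Morphisms

end
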